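/-
Copyright: the b2b-balaban T⁴-continuum CRUX team, row NE7b OWNER lineage `t4-ne7b-p1` (gen 117). Project licence.
-/
import Summits.QuantumFields.BalabanUV.T4Continuum.Spine.NE7b.SupTorusActionConvex
import Summits.QuantumFields.BalabanUV.T4Continuum.Spine.NE7b.SupPhiFourBackground

/-!
# THE BACKGROUND EXISTS FOR EVERY BLOCK FIELD WHEN THE POTENTIAL IS `λ`-SEMICONVEX WITH `λ < min(2,a)`: on the fine torus
# `(ℤ∕(n+1)s)^d`, for the action `S φ = ½Σ φ·(Rf(A(Ef φ))) + Σ v(φ x)` with `v′ = u`, `u′ ≥ −λ` EVERYWHERE (one-sided letter),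
# every block-average fibre `{Q′t φ = wt}` carries EXACTLY ONE solution of the sitewise equation, and it is the minimiser of `S` on
# the fibre — no chart, no small-field window, no smallness of `wt`; in particular for lattice `φ⁴_d` with `g ≥ 0` and
# `−m < min(2,a)` the background exists and is unique for ALL block fields
# (row NE7b, node U5c; (92) + TDF + INST + (86) BY NAME; [folklore])

Cell `pub-balaban`, sub-cell `t4`, spine estimate NE7b (`T4WeightBudget.RelWeightBound`; the cell's OWN estimate — NOT PRINTED in
[Bałaban 1983–89], NOT PROVED).  Crux-route work under `Spine/NE7b/` by the row OWNER (`t4-ne7b-p1` gen 117) under FREEZE (0)'s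
crux-prover clause, on leaf-03 g156's located item («NOT typed: … existence of critical points»); NOTHING of Bałaban's is named as a
Lean object, valued or asserted; no `T4Continuum/Support` leaf typed; no `def`, no notation; zero `sorry`.  Imports (BY NAME): the
OWNER's (92) `…SupTorusActionConvex` (`action_firstOrder_lower`, `hasDerivAt_action_line`, `eq_of_critical_of_critical`; through it
(89), TEA, TDF `sum_blockLift_mul_eq_zero` ∕ `blockOf_siteOf_of_mem` ∕ `blockOf_siteOf`, INST `fderiv_action_torus_eq_zero` ∕
`fieldEq_periodic`, PTC `apply_windowMap_siteOf`) and the OWNER's (86) `…SupPhiFourBackground` (`hasDerivAt_phiFour`).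

WHY (located).  The sup road produces the background by a contraction in `ℓ^∞` (ASE ∕ (58) ∕ (60)), hence on a small ball of block
fields, for potentials with TWO-sided curvature letters `|u′| ≤ λ`, `2λ ≤ c < N⁻¹`.  (92) showed that on the torus the action is
strongly convex as soon as `u′ ≥ −λ` with `λ` below the Dirichlet floor `min(2,a)` of (89).  Strong convexity does more than
uniqueness: the first-order letter at any `φ₀` bounds the sublevel set `{S ≤ S φ₀}` of the (closed) fibre by a ball, so the continuous
`S` attains its infimum on the fibre (finite dimension: closed balls are compact); a fibre minimiser is fibre-critical (differentiate
along `φ + t•h`, `h ∈ ker Q′t`); and on the torus fibre-criticality IS the sitewise equation — a covector killing the fields with zero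
block means is the block lift of its own block mean (TDF's adjointness), which is SBTL's closed-ball letter read back on the lattice.
No upper bound on `u′` is used: the quartic `φ⁴` term only helps, so for `g ≥ 0` the only condition is on the mass, `−m < min(2,a)`.

WHAT IS PROVED ([folklore]):
* §1 (finite carrier `ι`, Pi norm) `norm_sq_le_sum_sq` (`‖f‖² ≤ Σ_x (f x)²`), **`exists_isMinOn_of_firstOrder`** (a continuous `S`
  with a first-order letter `S φ₀ + L(ψ − φ₀) + (m∕2)Σ(ψ − φ₀)² ≤ S ψ`, `m > 0`, on a closed set `F ∋ φ₀` attains its minimum on `F`).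
* §2 (TEA's level: symmetric `At` with a form floor `γ`, `v′ = u`, `u′ ≥ −λ`, `λ < γ`; ANY `Qt`) **`exists_isMinOn_fibre`** (every fibre
  `{Qt ψ = Qt φ₀}` carries a minimiser of `S`), **`critical_of_isMinOn_fibre`** (a fibre minimiser is fibre-critical: `DS(φ)` kills
  `ker Qt`), **`existsUnique_critical_fibre`** (exactly one fibre-critical field per fibre, and it minimises).
* §3 (the `Beta.Site` carriers, displayed actions) `blockAvg_blockLift` (`Q′t (c∘bt) = c`), **`blockLift_of_critical`** (a torus covector
  killing `ker Q′t` is the block lift of its block mean), `apply_eq_restrict_siteOf` ∕ **`sitewise_of_critical`** (fibre-criticality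
  of `S` at `φt` ⟹ SBTL's LATTICE sitewise equation for `A(Ef φt) + u∘(Ef φt)`), and THE END **`existsUnique_torus_background`**:
  `u′ ≥ −λ` on `ℝ`, `λ < min(2,a)` ⟹ for EVERY coarse torus field `wt` there is EXACTLY ONE fine torus field `φt` with torus block
  means `wt` solving the sitewise equation, and it minimises `S` on its fibre.
* §4 **`existsUnique_phiFour_torus_background`** (`u t = g t³ + m t`, `v t = (g∕4)t⁴ + (m∕2)t²`, `0 ≤ g`, `−m < min(2,a)`; every
  `n, s, d`, every `wt`).
* §5 toy.

HONEST (what this is NOT).  Finite-dimensional convex analysis + (89)∕(92); the window `λ < min(2,a)` is OURS (from B6QGQLower276's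
constant, not sharp); ONE-SIDED curvature only — nothing here controls `u′` from above, so none of the sup road's LOCALITY ∕
regularity letters ((62)–(85): exponential decoupling, gradient letters, chart radius) follow from this file, and the identification
with SBTL's `σt` holds only where SBTL's letters hold (by (92) `torus_background_unique` ∕ SBTL's uniqueness clause, not restated);
no statement about the measure; cubic periods; scalar skeleton, hard constraint, not the covariant operators ((A3), NC-NE7b-α
UNRULED); nothing of Bałaban's.  BY-NAME EFFECT ON THE WALL: NONE.  NE7b NOT PRINTED ∕ NOT PROVED; spine PROVED 0∕9; rung (B)+1 on
a FINITE torus — NOT infinite volume, NOT the mass gap, NOT Clay.  HONEST DEPENDENCY: continuum YM on T⁴ ⇐ BetaPertH ∧ nine spine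
estimates (0∕9 proved); BetaPertH ⇐ (D1) ∧ (D4) ∧ CAP+tail; G-an2-4 gates asym, D1 and NE2∕3∕4.
-/

set_option autoImplicit false

noncomputable section

namespace Summit.QuantumFields.BalabanUV.T4Continuum.NE7b.SupTorusActionMinimiser

open Set Function Metric
open scoped ENNReal Topology
open Literature.MathematicalPhysics.QuantumFieldTheory.Balaban1983to89
open B6QGQLower276 (X blk B side AX mem_B sum_B_const)
open B5Hk103ScalarZd (nbhd)
open Beta (Site siteOf windowMap siteOf_windowMap)
open PeriodicSupTorusCarrier (apply_windowMap_siteOf)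
open SupTorusDirichletForm (torus_operator_form_symm sum_blockLift_mul_eq_zero blockOf_siteOf_of_mem blockOf_siteOf)
open SupTorusDirichletFormCoercive (torus_form_coercive)
open SupTorusEffectiveAction (exists_clm_pair hasFDerivAt_action fderiv_action_apply differentiableAt_action)
open SupTorusEffectiveActionInstance (fderiv_action_torus_eq_zero fieldEq_periodic)
open SupTorusActionConvex (action_firstOrder_lower hasDerivAt_action_line action_fibre_lower_of_critical
  eq_of_critical_of_critical)
open SupPhiFourBackground (hasDerivAt_phiFour)

variable {d : ℕ}

/-! ## §1. A continuous function with a first-order letter attains its minimum on a closed set -/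

section FirstOrder

variable {ι : Type*} [Fintype ι]

/-- On a finite carrier with the Pi (sup) norm, `‖f‖² ≤ Σ_x (f x)²`. [folklore] -/
theorem norm_sq_le_sum_sq (f : ι → ℝ) : ‖f‖ ^ 2 ≤ ∑ x, f x ^ 2 := by
  have hs : 0 ≤ ∑ x, f x ^ 2 := Finset.sum_nonneg fun x _ => sq_nonneg _
  have h : ‖f‖ ≤ Real.sqrt (∑ x, f x ^ 2) :=
    (pi_norm_le_iff_of_nonneg (Real.sqrt_nonneg _)).2 fun x => by
      rw [Real.norm_eq_abs]
      exact Real.abs_le_sqrt (Finset.single_le_sum (fun y _ => sq_nonneg (f y)) (Finset.mem_univ x))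
  calc ‖f‖ ^ 2 ≤ Real.sqrt (∑ x, f x ^ 2) ^ 2 := pow_le_pow_left₀ (norm_nonneg _) h 2
    _ = ∑ x, f x ^ 2 := Real.sq_sqrt hs

/-- **A CONTINUOUS FUNCTION WITH A FIRST-ORDER LETTER ATTAINS ITS MINIMUM ON A CLOSED SET**: `F` closed, `φ₀ ∈ F`, `S` continuous, and
`S φ₀ + L(ψ − φ₀) + (m∕2)·Σ_x (ψ − φ₀)² ≤ S ψ` on `F` with `m > 0` ⟹ `∃ φ ∈ F, IsMinOn S F φ` (the sublevel set `{S ≤ S φ₀} ∩ F` lies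
in the closed ball of radius `2‖L‖∕m` about `φ₀`, compact in finite dimension). [folklore] -/
theorem exists_isMinOn_of_firstOrder {S : (ι → ℝ) → ℝ} (hS : Continuous S) {F : Set (ι → ℝ)} (hF : IsClosed F) {φ₀ : ι → ℝ}
    (hφ₀ : φ₀ ∈ F) {L : (ι → ℝ) →L[ℝ] ℝ} {m : ℝ} (hm : 0 < m)
    (hfo : ∀ ψ ∈ F, S φ₀ + L (ψ - φ₀) + m / 2 * ∑ x, (ψ x - φ₀ x) ^ 2 ≤ S ψ) :
    ∃ φ ∈ F, IsMinOn S F φ := by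
  set R : ℝ := 2 * ‖L‖ / m with hR
  have hR0 : 0 ≤ R := div_nonneg (mul_nonneg zero_le_two (norm_nonneg _)) hm.le
  -- the sublevel set of `φ₀` inside `F` lies in the closed ball of radius `R`
  have hbound : ∀ ψ ∈ F, S ψ ≤ S φ₀ → dist ψ φ₀ ≤ R := by
    intro ψ hψ hle
    have h1 := hfo ψ hψ
    have hsum : ‖ψ - φ₀‖ ^ 2 ≤ ∑ x, (ψ x - φ₀ x) ^ 2 := by
      have := norm_sq_le_sum_sq (ψ - φ₀)
      simpa only [Pi.sub_apply] using this
    have hL : -(L (ψ - φ₀)) ≤ ‖L‖ * ‖ψ - φ₀‖ :=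
      (neg_le_abs _).trans (by simpa only [Real.norm_eq_abs] using L.le_opNorm (ψ - φ₀))
    have hkey : m / 2 * ‖ψ - φ₀‖ ^ 2 ≤ ‖L‖ * ‖ψ - φ₀‖ := by
      have : m / 2 * ∑ x, (ψ x - φ₀ x) ^ 2 ≤ -(L (ψ - φ₀)) := by linarith
      exact ((mul_le_mul_of_nonneg_left hsum (by positivity)).trans this).trans hL
    rw [dist_eq_norm]
    by_cases h0 : ‖ψ - φ₀‖ = 0
    · rw [h0]; exact hR0
    · have hpos : 0 < ‖ψ - φ₀‖ := (norm_nonneg _).lt_of_ne (Ne.symm h0)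
      have h2 : m / 2 * ‖ψ - φ₀‖ * ‖ψ - φ₀‖ ≤ ‖L‖ * ‖ψ - φ₀‖ := by rw [mul_assoc, ← sq]; exact hkey
      have h3 : m / 2 * ‖ψ - φ₀‖ ≤ ‖L‖ := le_of_mul_le_mul_right h2 hpos
      rw [hR, le_div_iff₀ hm]
      linarith
  -- minimise on the compact set `F ∩ closedBall φ₀ R`
  have hK : IsCompact (F ∩ closedBall φ₀ R) := (isCompact_closedBall φ₀ R).inter_left hF
  have hφ₀K : φ₀ ∈ F ∩ closedBall φ₀ R := ⟨hφ₀, mem_closedBall_self hR0⟩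
  obtain ⟨φ, hφK, hmin⟩ := hK.exists_isMinOn ⟨φ₀, hφ₀K⟩ hS.continuousOn
  refine ⟨φ, hφK.1, isMinOn_iff.2 fun ψ hψ => ?_⟩
  by_cases hle : S ψ ≤ S φ₀
  · exact isMinOn_iff.1 hmin ψ ⟨hψ, mem_closedBall.2 (hbound ψ hψ hle)⟩
  · exact (isMinOn_iff.1 hmin φ₀ hφ₀K).trans (le_of_lt (not_le.1 hle))

end FirstOrder

/-! ## §2. TEA's level: every fibre carries exactly one critical field, the minimiser -/

section Generic

variable {ι κ : Type*} [Fintype ι]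

/-- **EVERY BLOCK-AVERAGE FIBRE CARRIES A MINIMISER OF THE ACTION** (symmetric `At` with a form floor `γ`, `v′ = u`, `u′ ≥ −λ`,
`λ < γ`; ANY `Qt`): `∃ φ, Qt φ = Qt φ₀ ∧ IsMinOn S {ψ | Qt ψ = Qt φ₀} φ`. [folklore] -/
theorem exists_isMinOn_fibre (At : (ι → ℝ) →L[ℝ] (ι → ℝ))
    (hAt : ∀ φ ψ : ι → ℝ, ∑ x, ψ x * At φ x = ∑ x, φ x * At ψ x) {γ : ℝ}
    (hγ : ∀ h : ι → ℝ, γ * ∑ x, h x ^ 2 ≤ ∑ x, h x * At h x) {v u u' : ℝ → ℝ} (hv : ∀ t, HasDerivAt v (u t) t)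
    (hu : ∀ t, HasDerivAt u (u' t) t) {lam : ℝ} (hu' : ∀ t, -lam ≤ u' t) (hγlam : lam < γ) (Qt : (ι → ℝ) →L[ℝ] (κ → ℝ))
    (φ₀ : ι → ℝ) :
    ∃ φ : ι → ℝ, Qt φ = Qt φ₀ ∧
      IsMinOn (fun φ : ι → ℝ => (1 / 2 : ℝ) * ∑ x, φ x * At φ x + ∑ x, v (φ x)) {ψ | Qt ψ = Qt φ₀} φ := by
  have hcont : Continuous (fun φ : ι → ℝ => (1 / 2 : ℝ) * ∑ x, φ x * At φ x + ∑ x, v (φ x)) :=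
    (show Differentiable ℝ (fun φ : ι → ℝ => (1 / 2 : ℝ) * ∑ x, φ x * At φ x + ∑ x, v (φ x)) from
      fun φ => differentiableAt_action At hAt hv φ).continuous
  have hF : IsClosed {ψ : ι → ℝ | Qt ψ = Qt φ₀} := isClosed_eq Qt.continuous continuous_const
  obtain ⟨L, hL⟩ := exists_clm_pair (fun x => At φ₀ x + u (φ₀ x))
  have hfo : ∀ ψ ∈ {ψ : ι → ℝ | Qt ψ = Qt φ₀},
      ((1 / 2 : ℝ) * ∑ x, φ₀ x * At φ₀ x + ∑ x, v (φ₀ x)) + L (ψ - φ₀) + (γ - lam) / 2 * ∑ x, (ψ x - φ₀ x) ^ 2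
        ≤ (1 / 2 : ℝ) * ∑ x, ψ x * At ψ x + ∑ x, v (ψ x) := by
    intro ψ _
    have h := action_firstOrder_lower At hAt hγ hv hu hu' φ₀ ψ
    rw [fderiv_action_apply At hAt hv φ₀ (ψ - φ₀)] at h
    rw [hL]
    exact h
  obtain ⟨φ, hφ, hmin⟩ := exists_isMinOn_of_firstOrder hcont hF (show φ₀ ∈ {ψ : ι → ℝ | Qt ψ = Qt φ₀} from rfl)
    (sub_pos.2 hγlam) hfo
  exact ⟨φ, hφ, hmin⟩

/-- **A FIBRE MINIMISER IS FIBRE-CRITICAL**: if `φ` minimises `S` on `{ψ | Qt ψ = Qt φ}` then `DS(φ) h = 0` for every `h ∈ ker Qt`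
(differentiate `t ↦ S(φ + t•h)` at its minimum `t = 0`). [folklore] -/
theorem critical_of_isMinOn_fibre (At : (ι → ℝ) →L[ℝ] (ι → ℝ))
    (hAt : ∀ φ ψ : ι → ℝ, ∑ x, ψ x * At φ x = ∑ x, φ x * At ψ x) {v u : ℝ → ℝ} (hv : ∀ t, HasDerivAt v (u t) t)
    (Qt : (ι → ℝ) →L[ℝ] (κ → ℝ)) {φ : ι → ℝ}
    (hmin : IsMinOn (fun φ : ι → ℝ => (1 / 2 : ℝ) * ∑ x, φ x * At φ x + ∑ x, v (φ x)) {ψ | Qt ψ = Qt φ} φ)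
    (h : ι → ℝ) (hh : Qt h = 0) :
    fderiv ℝ (fun φ : ι → ℝ => (1 / 2 : ℝ) * ∑ x, φ x * At φ x + ∑ x, v (φ x)) φ h = 0 := by
  -- the segment `φ + t•h` stays in the fibre, so `t = 0` is a minimum of the action along it
  have hloc : IsLocalMin (fun t : ℝ => (1 / 2 : ℝ) * ∑ x, (φ + t • h) x * At (φ + t • h) x + ∑ x, v ((φ + t • h) x)) 0 := by
    refine Filter.Eventually.of_forall fun t => ?_
    have hmem : φ + t • h ∈ {ψ : ι → ℝ | Qt ψ = Qt φ} := by
      show Qt (φ + t • h) = Qt φ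
      rw [map_add, map_smul, hh, smul_zero, add_zero]
    have hle := isMinOn_iff.1 hmin (φ + t • h) hmem
    simpa only [zero_smul, add_zero] using hle
  have hder := hloc.hasDerivAt_eq_zero (hasDerivAt_action_line At hAt hv φ h 0)
  simp only [zero_smul, add_zero] at hder
  rw [fderiv_action_apply At hAt hv φ h]
  exact hder

/-- **EXACTLY ONE FIBRE-CRITICAL FIELD PER FIBRE, AND IT MINIMISES** (`λ < γ`): there is a unique `φ` with `Qt φ = Qt φ₀` whose
differential kills `ker Qt`, and it minimises `S` on the fibre. [folklore] -/
theorem existsUnique_critical_fibre (At : (ι → ℝ) →L[ℝ] (ι → ℝ))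
    (hAt : ∀ φ ψ : ι → ℝ, ∑ x, ψ x * At φ x = ∑ x, φ x * At ψ x) {γ : ℝ}
    (hγ : ∀ h : ι → ℝ, γ * ∑ x, h x ^ 2 ≤ ∑ x, h x * At h x) {v u u' : ℝ → ℝ} (hv : ∀ t, HasDerivAt v (u t) t)
    (hu : ∀ t, HasDerivAt u (u' t) t) {lam : ℝ} (hu' : ∀ t, -lam ≤ u' t) (hγlam : lam < γ) (Qt : (ι → ℝ) →L[ℝ] (κ → ℝ))
    (φ₀ : ι → ℝ) :
    (∃! φ : ι → ℝ, Qt φ = Qt φ₀ ∧ ∀ h : ι → ℝ, Qt h = 0 →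
      fderiv ℝ (fun φ : ι → ℝ => (1 / 2 : ℝ) * ∑ x, φ x * At φ x + ∑ x, v (φ x)) φ h = 0) ∧
    ∀ φ : ι → ℝ, Qt φ = Qt φ₀ →
      (∀ h : ι → ℝ, Qt h = 0 → fderiv ℝ (fun φ : ι → ℝ => (1 / 2 : ℝ) * ∑ x, φ x * At φ x + ∑ x, v (φ x)) φ h = 0) →
      IsMinOn (fun φ : ι → ℝ => (1 / 2 : ℝ) * ∑ x, φ x * At φ x + ∑ x, v (φ x)) {ψ | Qt ψ = Qt φ₀} φ := by
  obtain ⟨φ, hφ, hmin⟩ := exists_isMinOn_fibre At hAt hγ hv hu hu' hγlam Qt φ₀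
  have hmin' : IsMinOn (fun φ : ι → ℝ => (1 / 2 : ℝ) * ∑ x, φ x * At φ x + ∑ x, v (φ x)) {ψ | Qt ψ = Qt φ} φ := by
    rw [hφ]; exact hmin
  have hcrit := critical_of_isMinOn_fibre At hAt hv Qt hmin'
  refine ⟨⟨φ, ⟨hφ, hcrit⟩, fun ψ hψ => ?_⟩, fun ψ hψQ hψcrit => ?_⟩
  · exact eq_of_critical_of_critical At hAt hγ hv hu hu' hγlam Qt (hφ.trans hψ.1.symm) hψ.2 hcrit
  · have heq : φ = ψ := eq_of_critical_of_critical At hAt hγ hv hu hu' hγlam Qt (hψQ.trans hφ.symm) hcrit hψcrit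
    rw [← heq]; exact hmin

end Generic

/-! ## §3. The torus: fibre-criticality is the sitewise equation; the END -/

section Torus

variable (n : ℕ) (a : ℝ) (s : ℕ) [NeZero s]
  {Dop Aop : lp (fun _ : X d => ℝ) ∞ →L[ℝ] lp (fun _ : X d => ℝ) ∞}
  (hD : ∀ (f : lp (fun _ : X d => ℝ) ∞) (y : X d), Dop f y = (((n : ℝ) + 1) ^ d)⁻¹ * ∑ p ∈ B n y, f p)
  (hA : ∀ (f : lp (fun _ : X d => ℝ) ∞) (p : X d), Aop f p = ∑ r ∈ nbhd n p, AX n a p r * f r)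
  {Ef : (Site d ((n + 1) * s) → ℝ) →L[ℝ] lp (fun _ : X d => ℝ) ∞}
  (hEf : ∀ (g : Site d ((n + 1) * s) → ℝ) (q : X d), Ef g q = g (siteOf d ((n + 1) * s) q))
  {Rf : lp (fun _ : X d => ℝ) ∞ →L[ℝ] (Site d ((n + 1) * s) → ℝ)}
  (hRf : ∀ (h : lp (fun _ : X d => ℝ) ∞) (x : Site d ((n + 1) * s)), Rf h x = h (windowMap d ((n + 1) * s) x))
  {Rc : lp (fun _ : X d => ℝ) ∞ →L[ℝ] (Site d s → ℝ)}
  (hRc : ∀ (h : lp (fun _ : X d => ℝ) ∞) (x : Site d s), Rc h x = h (windowMap d s x))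

include hD hEf hRc in
/-- **THE TORUS BLOCK MEAN OF A BLOCK LIFT IS THE COARSE FIELD**: `Q′t (c ∘ bt) = c`, `bt x = siteOf (blk n (windowMap x))`. [folklore] -/
theorem blockAvg_blockLift (c : Site d s → ℝ) :
    ((Rc.comp Dop).comp Ef) (fun x => c (siteOf d s (blk n (windowMap d ((n + 1) * s) x)))) = c := by
  funext y
  rw [ContinuousLinearMap.comp_apply, ContinuousLinearMap.comp_apply, hRc, hD]
  simp only [hEf]
  have hvol : (((n : ℝ) + 1) ^ d) ≠ 0 := by positivity
  rw [Finset.sum_congr rfl fun p hp => by rw [blockOf_siteOf_of_mem n s hp], sum_B_const, inv_mul_cancel_left₀ hvol]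

include hD hEf hRc in
/-- **A TORUS COVECTOR KILLING THE FIBRE IS THE BLOCK LIFT OF ITS BLOCK MEAN**: if `Σ_x F x·h x = 0` for every torus field `h` with zero
torus block means, then `F x = (Q′t F)(bt x)` at every fine torus site. [folklore] -/
theorem blockLift_of_critical (F : Site d ((n + 1) * s) → ℝ)
    (hF : ∀ h : Site d ((n + 1) * s) → ℝ, ((Rc.comp Dop).comp Ef) h = 0 → ∑ x, F x * h x = 0) (x : Site d ((n + 1) * s)) :
    F x = ((Rc.comp Dop).comp Ef) F (siteOf d s (blk n (windowMap d ((n + 1) * s) x))) := by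
  set c : Site d s → ℝ := ((Rc.comp Dop).comp Ef) F with hc
  set h : Site d ((n + 1) * s) → ℝ := fun x => F x - c (siteOf d s (blk n (windowMap d ((n + 1) * s) x))) with hh
  have hQh : ((Rc.comp Dop).comp Ef) h = 0 := by
    have hsub : h = F - fun x => c (siteOf d s (blk n (windowMap d ((n + 1) * s) x))) := rfl
    rw [hsub, map_sub, blockAvg_blockLift n s hD hEf hRc c, hc, sub_self]
  have hQh' : Rc (Dop (Ef h)) = 0 := by simpa only [ContinuousLinearMap.comp_apply] using hQh
  have h0 := hF h hQh
  -- `Σ F·h = Σ h² + Σ (c∘bt)·h` and the second sum vanishes on the fibre (TDF)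
  have hsplit : ∑ x, F x * h x = ∑ x, h x ^ 2 + ∑ x, c (siteOf d s (blk n (windowMap d ((n + 1) * s) x))) * h x := by
    rw [← Finset.sum_add_distrib]
    exact Finset.sum_congr rfl fun x _ => by simp only [hh]; ring
  rw [hsplit, sum_blockLift_mul_eq_zero n s hD hEf hRc c hQh', add_zero] at h0
  have hx := (Finset.sum_eq_zero_iff_of_nonneg fun x _ => sq_nonneg (h x)).1 h0 x (Finset.mem_univ x)
  rw [sq_eq_zero_iff, hh] at hx
  exact sub_eq_zero.1 hx

include hRf in
/-- A periodic lattice field is read through the window restriction: `G q = (Rf G)(siteOf q)`. [folklore] -/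
theorem apply_eq_restrict_siteOf {G : lp (fun _ : X d => ℝ) ∞}
    (hper : ∀ q t : X d, G (q + side n • ((s : ℤ) • t)) = G q) (q : X d) :
    G q = Rf G (siteOf d ((n + 1) * s) q) := by
  rw [hRf]
  have hper' : ∀ q t : X d, (G : X d → ℝ) (q + (((n + 1) * s : ℕ) : ℤ) • t) = G q := fun q t => by
    rw [PeriodicSupTorusCarrier.natCast_mul_smul_eq]; exact hper q t
  exact (apply_windowMap_siteOf hper' q).symm

include hD hA hEf hRf hRc in
/-- **FIBRE-CRITICALITY ON THE TORUS IS THE LATTICE SITEWISE EQUATION**: if `DS(φt)` kills every torus field with zero torus block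
means, then `A(Ef φt) + u∘(Ef φt)` equals its own block mean at every lattice site (SBTL's closed-ball letter). [folklore] -/
theorem sitewise_of_critical {v u : ℝ → ℝ} (hv : ∀ t, HasDerivAt v (u t) t) (φt : Site d ((n + 1) * s) → ℝ)
    (hcrit : ∀ h : Site d ((n + 1) * s) → ℝ, ((Rc.comp Dop).comp Ef) h = 0 →
      fderiv ℝ (fun φ : Site d ((n + 1) * s) → ℝ =>
        (1 / 2 : ℝ) * ∑ x, φ x * ((Rf.comp Aop).comp Ef) φ x + ∑ x, v (φ x)) φt h = 0)
    (p : X d) :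
    Aop (Ef φt) p + u (Ef φt p)
      = (((n : ℝ) + 1) ^ d)⁻¹ * ∑ p' ∈ B n (blk n p), (Aop (Ef φt) p' + u (Ef φt p')) := by
  -- the torus covector `F = Rf(A(Ef φt)) + u∘φt` kills the fibre, hence is the block lift of its block mean
  set F : Site d ((n + 1) * s) → ℝ := fun x => ((Rf.comp Aop).comp Ef) φt x + u (φt x) with hFdef
  have hF : ∀ h : Site d ((n + 1) * s) → ℝ, ((Rc.comp Dop).comp Ef) h = 0 → ∑ x, F x * h x = 0 := fun h hh => by
    have h0 := hcrit h hh
    rw [fderiv_action_apply ((Rf.comp Aop).comp Ef) (torus_operator_form_symm n a s hA hEf hRf) hv φt h] at h0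
    exact h0
  have hlift := blockLift_of_critical n s hD hEf hRc F hF
  -- the lattice field `G = A(Ef φt) + u∘(Ef φt)` is periodic and reads `G q = F(siteOf q)`
  have hper : ∀ q t : X d, (Aop (Ef φt) : X d → ℝ) (q + side n • ((s : ℤ) • t)) + u (Ef φt (q + side n • ((s : ℤ) • t)))
      = Aop (Ef φt) q + u (Ef φt q) := fun q t => fieldEq_periodic n a s hA hEf φt u q t
  have hperA : ∀ q t : X d, (Aop (Ef φt) : X d → ℝ) (q + side n • ((s : ℤ) • t)) = Aop (Ef φt) q := fun q t => by
    have h1 := hper q t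
    have h2 : (Ef φt : X d → ℝ) (q + side n • ((s : ℤ) • t)) = Ef φt q := by
      rw [hEf, hEf, ← PeriodicSupTorusCarrier.natCast_mul_smul_eq, PeriodicSupTorusCarrier.siteOf_add_smul]
    rw [h2] at h1
    linarith
  have hG : ∀ q : X d, Aop (Ef φt) q + u (Ef φt q) = F (siteOf d ((n + 1) * s) q) := fun q => by
    simp only [hFdef, ContinuousLinearMap.comp_apply]
    rw [apply_eq_restrict_siteOf n s hRf hperA q, hEf]
  -- both sides are `c (siteOf (blk n p))`, `c` the torus block mean of `F`
  have hc : ∀ q : X d, F (siteOf d ((n + 1) * s) q)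
      = ((Rc.comp Dop).comp Ef) F (siteOf d s (blk n q)) := fun q => by
    rw [hlift (siteOf d ((n + 1) * s) q), blockOf_siteOf]
  rw [hG p, hc p]
  rw [Finset.sum_congr rfl fun p' (hp' : p' ∈ B n (blk n p)) => by rw [hG p', hc p', mem_B.1 hp'], sum_B_const,
    inv_mul_cancel_left₀ (by positivity : (((n : ℝ) + 1) ^ d) ≠ 0)]

include hD hA hEf hRf hRc in
/-- **THE END: FOR A `λ`-SEMICONVEX POTENTIAL WITH `λ < min(2,a)` THE TORUS BACKGROUND EXISTS AND IS UNIQUE FOR EVERY BLOCK FIELD.**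
`v′ = u`, `u′ ≥ −λ` on `ℝ`, `λ < min(2,a)` ⟹ for every coarse torus field `wt` there is EXACTLY ONE fine torus field `φt` with torus
block means `wt` solving the sitewise equation (`A(Ef φt) + u∘(Ef φt)` equals its own block mean at every lattice site), AND every such
`φt` minimises `S` on its block-average fibre — every mesh `n`, period `s`, dimension `d`; no smallness of `wt`. [folklore] -/
theorem existsUnique_torus_background {v u u' : ℝ → ℝ} (hv : ∀ t, HasDerivAt v (u t) t) (hu : ∀ t, HasDerivAt u (u' t) t)
    {lam : ℝ} (hu' : ∀ t, -lam ≤ u' t) (hγ : lam < min 2 a) (wt : Site d s → ℝ) :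
    (∃! φt : Site d ((n + 1) * s) → ℝ, ((Rc.comp Dop).comp Ef) φt = wt ∧
      ∀ p : X d, Aop (Ef φt) p + u (Ef φt p)
        = (((n : ℝ) + 1) ^ d)⁻¹ * ∑ p' ∈ B n (blk n p), (Aop (Ef φt) p' + u (Ef φt p'))) ∧
    ∀ φt : Site d ((n + 1) * s) → ℝ, ((Rc.comp Dop).comp Ef) φt = wt →
      (∀ p : X d, Aop (Ef φt) p + u (Ef φt p)
        = (((n : ℝ) + 1) ^ d)⁻¹ * ∑ p' ∈ B n (blk n p), (Aop (Ef φt) p' + u (Ef φt p'))) →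
      IsMinOn (fun φ : Site d ((n + 1) * s) → ℝ => (1 / 2 : ℝ) * ∑ x, φ x * ((Rf.comp Aop).comp Ef) φ x + ∑ x, v (φ x))
        {ψ | ((Rc.comp Dop).comp Ef) ψ = wt} φt := by
  -- the block lift `wt ∘ bt` lies on the fibre of `wt`
  set φ₀ : Site d ((n + 1) * s) → ℝ := fun x => wt (siteOf d s (blk n (windowMap d ((n + 1) * s) x))) with hφ₀
  have hQ₀ : ((Rc.comp Dop).comp Ef) φ₀ = wt := blockAvg_blockLift n s hD hEf hRc wt
  have hsymm := torus_operator_form_symm n a s hA hEf hRf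
  have hfloor := torus_form_coercive n a s hA hEf hRf
  obtain ⟨⟨φ, ⟨hφQ, hφcrit⟩, huniq⟩, hmin⟩ :=
    existsUnique_critical_fibre ((Rf.comp Aop).comp Ef) hsymm hfloor hv hu hu' hγ ((Rc.comp Dop).comp Ef) φ₀
  rw [hQ₀] at hφQ hmin
  refine ⟨⟨φ, ⟨hφQ, sitewise_of_critical n a s hD hA hEf hRf hRc hv φ hφcrit⟩, fun ψ hψ => huniq ψ ⟨hψ.1.trans hQ₀.symm, ?_⟩⟩,
    fun φt hφt heq => hmin φt hφt fun h hh => fderiv_action_torus_eq_zero n a s hD hA hEf hRf hRc hv φt heq h hh⟩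
  exact fun h hh => fderiv_action_torus_eq_zero n a s hD hA hEf hRf hRc hv ψ hψ.2 h hh

end Torus

/-! ## §4. Lattice `φ⁴`: the background exists and is unique for every block field when `g ≥ 0`, `−m < min(2,a)` -/

/-- `v(t) = (g∕4)t⁴ + (m∕2)t²` has derivative `u(t) = g t³ + m t`. [folklore] -/
theorem hasDerivAt_phiFour_potential (g m t : ℝ) :
    HasDerivAt (fun t : ℝ => g / 4 * t ^ 4 + m / 2 * t ^ 2) (g * t ^ 3 + m * t) t := by
  have h1 : HasDerivAt (fun t : ℝ => g / 4 * t ^ 4) (g / 4 * ((4 : ℕ) * t ^ (4 - 1))) t := (hasDerivAt_pow 4 t).const_mul _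
  have h2 : HasDerivAt (fun t : ℝ => m / 2 * t ^ 2) (m / 2 * ((2 : ℕ) * t ^ (2 - 1))) t := (hasDerivAt_pow 2 t).const_mul _
  refine (h1.add h2).congr_deriv ?_
  push_cast
  ring

/-- **THE `φ⁴_d` TORUS BACKGROUND EXISTS AND IS UNIQUE FOR EVERY BLOCK FIELD** (`u t = g t³ + m t`, `0 ≤ g`, `−m < min(2,a)`; every
side `n + 1`, period `s ≥ 1`, dimension `d`; ANY operators ∕ carrier maps with the displayed actions): for every coarse torus field
`wt` there is exactly one fine torus field `φt` with torus block means `wt` such that `A(Ef φt) p + g(Ef φt p)³ + m(Ef φt p)` equals its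
own block mean at every lattice site `p`, and it minimises the `φ⁴` action `½Σ φ·(Rf(A(Ef φ))) + Σ ((g∕4)φ⁴ + (m∕2)φ²)` on its fibre —
the quartic only helps: no coupling window, no field window. [folklore] -/
theorem existsUnique_phiFour_torus_background (n : ℕ) (a : ℝ) (s : ℕ) [NeZero s]
    {Dop Aop : lp (fun _ : X d => ℝ) ∞ →L[ℝ] lp (fun _ : X d => ℝ) ∞}
    (hD : ∀ (f : lp (fun _ : X d => ℝ) ∞) (y : X d), Dop f y = (((n : ℝ) + 1) ^ d)⁻¹ * ∑ p ∈ B n y, f p)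
    (hA : ∀ (f : lp (fun _ : X d => ℝ) ∞) (p : X d), Aop f p = ∑ r ∈ nbhd n p, AX n a p r * f r)
    {Ef : (Site d ((n + 1) * s) → ℝ) →L[ℝ] lp (fun _ : X d => ℝ) ∞}
    (hEf : ∀ (g : Site d ((n + 1) * s) → ℝ) (q : X d), Ef g q = g (siteOf d ((n + 1) * s) q))
    {Rf : lp (fun _ : X d => ℝ) ∞ →L[ℝ] (Site d ((n + 1) * s) → ℝ)}
    (hRf : ∀ (h : lp (fun _ : X d => ℝ) ∞) (x : Site d ((n + 1) * s)), Rf h x = h (windowMap d ((n + 1) * s) x))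
    {Rc : lp (fun _ : X d => ℝ) ∞ →L[ℝ] (Site d s → ℝ)}
    (hRc : ∀ (h : lp (fun _ : X d => ℝ) ∞) (x : Site d s), Rc h x = h (windowMap d s x))
    {g m : ℝ} (hg : 0 ≤ g) (hm : -m < min 2 a) (wt : Site d s → ℝ) :
    (∃! φt : Site d ((n + 1) * s) → ℝ, ((Rc.comp Dop).comp Ef) φt = wt ∧
      ∀ p : X d, Aop (Ef φt) p + (g * (Ef φt p) ^ 3 + m * Ef φt p)
        = (((n : ℝ) + 1) ^ d)⁻¹ * ∑ p' ∈ B n (blk n p), (Aop (Ef φt) p' + (g * (Ef φt p') ^ 3 + m * Ef φt p'))) ∧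
    ∀ φt : Site d ((n + 1) * s) → ℝ, ((Rc.comp Dop).comp Ef) φt = wt →
      (∀ p : X d, Aop (Ef φt) p + (g * (Ef φt p) ^ 3 + m * Ef φt p)
        = (((n : ℝ) + 1) ^ d)⁻¹ * ∑ p' ∈ B n (blk n p), (Aop (Ef φt) p' + (g * (Ef φt p') ^ 3 + m * Ef φt p'))) →
      IsMinOn (fun φ : Site d ((n + 1) * s) → ℝ =>
          (1 / 2 : ℝ) * ∑ x, φ x * ((Rf.comp Aop).comp Ef) φ x + ∑ x, (g / 4 * (φ x) ^ 4 + m / 2 * (φ x) ^ 2))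
        {ψ | ((Rc.comp Dop).comp Ef) ψ = wt} φt :=
  existsUnique_torus_background n a s hD hA hEf hRf hRc (v := fun t => g / 4 * t ^ 4 + m / 2 * t ^ 2)
    (u := fun t => g * t ^ 3 + m * t) (u' := fun t => 3 * g * t ^ 2 + m) (hasDerivAt_phiFour_potential g m)
    (hasDerivAt_phiFour g m) (lam := -m) (fun t => by nlinarith [sq_nonneg t]) (by simpa using hm) wt

/-! ## §5. Toy -/

/-- Toy (§1): the zero function on a one-point carrier attains its minimum on the whole space (first-order letter with `L = 0`,
`m = 2`, read at `φ₀ = 0`). -/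
example : ∃ φ ∈ (Set.univ : Set (Unit → ℝ)), IsMinOn (fun ψ : Unit → ℝ => ∑ x, ψ x ^ 2) Set.univ φ :=
  exists_isMinOn_of_firstOrder (ι := Unit) (S := fun ψ : Unit → ℝ => ∑ x, ψ x ^ 2) (by fun_prop) isClosed_univ
    (Set.mem_univ (0 : Unit → ℝ)) (L := 0) (m := 2) two_pos (fun ψ _ => by simp)

end Summit.QuantumFields.BalabanUV.T4Continuum.NE7b.SupTorusActionMinimiser

end
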